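import Mathlib
import Literature.Analysis.FluidPDE.HardSphereCollisionRecord
import Literature.MathematicalPhysics.KineticTheory.HardSphereEuler
import Literature.MathematicalPhysics.KineticTheory.HardSphereEulerProofs
import Literature.MathematicalPhysics.KineticTheory.CollisionTubePullbackFlight
import Summits.AtomisticToContinuum.HydrodynamicLimit.Theorems.OneFlightGossipEngineOneFlightLayeredChaosGapMeasurable
import Summits.AtomisticToContinuum.HydrodynamicLimit.Theorems.OneFlightGossipEngineOneFlightLayeredChaosWindowEvent
import HarnessLib

/-!
# `OneFlightGossipEngine.OneFlightLayeredChaos` — the first collision of the tagged particle on a good orbit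
(crux stmt-AtomisticToContinuum-14535, line `Sketch`, serves the stub `stub_firstFlight_flux` — the `n = 0`, fresh-partner
rung — through the registered stub `window_sameStart_iff_firstFlight`; stub worker of lead cycle c3, 2026-08-16). Part of the Lean-checked reduction
`FirstFlightVelInput θ₀ → FirstFlightPairInput θ₀ → FirstFlightInput θ₀ → RegimeFluxBody θ₀ ((shortGap θ₀ 0).inter nZero)`
split over the files `…FirstCollision`, `…FluxFunctional`, `…PairMeasurable`, `…FirstFlightInput`,
`…FirstFlightPairInput`, `…FirstFlightVelInput` (grouping namespace `OLC`).

Deterministic lemmas at `n = 0`: the first collision time `t₀ = Φ.nthCollisionTimeOf i 0 z` is the least collision time of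
`i` in `(0, ∞)`; the window event `{1 ≤ #collisions of i in (0, w]}` is `{t₀ ∈ (0, w]}`; the flight start of `i` before
`t₀` is `0`, and that of a particle `k` is `0` iff `k` is FRESH (no collision in `(0, t₀)`); hence the crux's
window-and-same-start event at `n = 0` is the FIRST-FLIGHT event (`window_sameStart_iff_firstFlight`), on which both
snapshots of the coarse past are the time-`0` configuration (`coarsePastOf_eq_of_firstFlight`), the partners fly freely
up to `t₀` (`pos_eq_freeFlight_of_le`), the recorded impact vector is the free-flight contact normal
(`impactVec_eq_of_firstFlight`) and `t₀` is the ENTRANCE TIME of the two free flights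
(`isLeast_freeFlightEntrance_nthCollisionTimeOf_zero`); the first-flight event is measurable
(`measurableSet_firstFlightEvent`). No definitions.
-/

open scoped BigOperators ENNReal
open MeasureTheory Set
open Literature.Analysis.FluidPDE Literature.MathematicalPhysics.KineticTheory
open Summit.AtomisticToContinuum.HydrodynamicLimit.Theorems

namespace Summit.AtomisticToContinuum.HydrodynamicLimit.Theorems.OLC

noncomputable section

/-! ## Deterministic lemmas on a good orbit: the first collision of `i` -/

section FirstCollision

variable {σ : ℝ} {N : ℕ} (Φ : HardSphereFlow (Torus.geometry (Fin 3)) (hsDiameter σ N) (N + 1))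
  (i : Fin (N + 1)) {z : Config (N + 1) (Fin 3) T3}

/-- The first collision time of `i` after `0` is `nextTimeAfter` of its collision times. [folklore] -/
theorem nthCollisionTimeOf_zero_eq :
    Φ.nthCollisionTimeOf i 0 z =
      nextTimeAfter (collisionTimesOf (Torus.geometry (Fin 3)) (hsDiameter σ N) (fun t => Φ.flow t z) i) 0 :=
  rfl

/-- On a good orbit, if the first collision time `t₀` of `i` after `0` is positive then it is the least collision
time of `i` in `(0, ∞)`. [folklore] -/
theorem isLeast_of_nthCollisionTimeOf_zero_pos (hz : z ∈ Φ.good) (h0 : 0 < Φ.nthCollisionTimeOf i 0 z) :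
    IsLeast (collisionTimesOf (Torus.geometry (Fin 3)) (hsDiameter σ N) (fun t => Φ.flow t z) i ∩ Ioi 0)
      (Φ.nthCollisionTimeOf i 0 z) := by
  set S := collisionTimesOf (Torus.geometry (Fin 3)) (hsDiameter σ N) (fun t => Φ.flow t z) i with hS
  by_cases hne : (S ∩ Ioi 0).Nonempty
  · exact (Φ.isTrajectory z hz).isLeast_nthCollisionTimeOf_zero hne
  · exfalso
    have hempty : S ∩ Ioi 0 = ∅ := not_nonempty_iff_eq_empty.1 hne
    have : Φ.nthCollisionTimeOf i 0 z = 0 := by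
      rw [nthCollisionTimeOf_zero_eq, ← hS, nextTimeAfter_of_eq_empty hempty]
    exact (lt_irrefl (0 : ℝ)) (this ▸ h0)

/-- **The window event at `n = 0` on a good orbit**: `i` has at least one collision in `(0, w]` iff its first
collision time after `0` lies in `(0, w]`. [folklore] -/
theorem one_le_ncard_iff_nthCollisionTimeOf_zero_mem (hz : z ∈ Φ.good) (w : ℝ) :
    1 ≤ Set.ncard (collisionTimesOf (Torus.geometry (Fin 3)) (hsDiameter σ N) (fun t => Φ.flow t z) i ∩
        Set.Ioc 0 w) ↔ Φ.nthCollisionTimeOf i 0 z ∈ Ioc 0 w := by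
  set S := collisionTimesOf (Torus.geometry (Fin 3)) (hsDiameter σ N) (fun t => Φ.flow t z) i with hS
  have hfin : (S ∩ Ioc 0 w).Finite := (Φ.isTrajectory z hz).finite_collisionTimesOf_inter_Ioc i 0 w
  constructor
  · intro h1
    obtain ⟨s, hs, h0s, hsw⟩ := nonempty_of_ncard_ne_zero (s := S ∩ Ioc 0 w) (by omega)
    have hne : (S ∩ Ioi 0).Nonempty := ⟨s, hs, h0s⟩
    have hleast := (Φ.isTrajectory z hz).isLeast_nthCollisionTimeOf_zero hne
    exact ⟨hleast.1.2, (hleast.2 ⟨hs, h0s⟩).trans hsw⟩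
  · intro ht
    have hleast := isLeast_of_nthCollisionTimeOf_zero_pos Φ i hz ht.1
    have hmem : Φ.nthCollisionTimeOf i 0 z ∈ S ∩ Ioc 0 w := ⟨hleast.1.1, ht⟩
    exact Nat.one_le_iff_ne_zero.2 (ncard_ne_zero_of_mem hmem hfin)

/-- On a good orbit with `0 < t₀`: `i` takes part in no collision during `(0, t₀)`. [folklore] -/
theorem not_participates_of_lt_nthCollisionTimeOf_zero (hz : z ∈ Φ.good) (h0 : 0 < Φ.nthCollisionTimeOf i 0 z)
    {u : ℝ} (hu : u ∈ Ioo 0 (Φ.nthCollisionTimeOf i 0 z)) :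
    ¬ Participates (Torus.geometry (Fin 3)) (hsDiameter σ N) (Φ.flow u z) i := fun hpart =>
  (not_le.2 hu.2) ((isLeast_of_nthCollisionTimeOf_zero_pos Φ i hz h0).2 ⟨hpart, hu.1⟩)

/-- On a good orbit with `0 < t₀`, the flight start of `i` before its first collision time is time `0`. [folklore] -/
theorem flightStart_self_eq_zero (hz : z ∈ Φ.good) (h0 : 0 < Φ.nthCollisionTimeOf i 0 z) :
    flightStart (Torus.geometry (Fin 3)) (hsDiameter σ N) (fun t => Φ.flow t z) 0 i (Φ.nthCollisionTimeOf i 0 z) =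
      0 := by
  have hempty : collisionTimesOf (Torus.geometry (Fin 3)) (hsDiameter σ N) (fun t => Φ.flow t z) i ∩
      Ioo 0 (Φ.nthCollisionTimeOf i 0 z) = ∅ := by
    refine eq_empty_of_forall_notMem fun u hu => ?_
    exact not_participates_of_lt_nthCollisionTimeOf_zero Φ i hz h0 hu.2 hu.1
  rw [flightStart, hempty, insert_empty_eq, csSup_singleton]

/-- On a good orbit and for `0 < t`: the flight start of `k` before `t` is time `0` iff `k` takes part in no
collision during `(0, t)` (`k` is FRESH at `t`). [folklore] -/
theorem flightStart_eq_zero_iff (hz : z ∈ Φ.good) (k : Fin (N + 1)) {t : ℝ} (_ht : 0 < t) :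
    flightStart (Torus.geometry (Fin 3)) (hsDiameter σ N) (fun s => Φ.flow s z) 0 k t = 0 ↔
      ∀ u ∈ Ioo 0 t, ¬ Participates (Torus.geometry (Fin 3)) (hsDiameter σ N) (Φ.flow u z) k := by
  have hfin : (collisionTimesOf (Torus.geometry (Fin 3)) (hsDiameter σ N) (fun s => Φ.flow s z) k ∩
      Ioo 0 t).Finite := (Φ.isTrajectory z hz).finite_collisionTimesOf_inter_Ioo k 0 t
  constructor
  · intro h u hu hpart
    have hle := le_flightStart_of_mem hfin (s := u) hpart hu.1 hu.2
    rw [h] at hle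
    exact (not_le.2 hu.1) hle
  · intro h
    have hempty : collisionTimesOf (Torus.geometry (Fin 3)) (hsDiameter σ N) (fun s => Φ.flow s z) k ∩
        Ioo 0 t = ∅ := eq_empty_of_forall_notMem fun u hu => h u hu.2 hu.1
    rw [flightStart, hempty, insert_empty_eq, csSup_singleton]

/-- **The window-and-same-start event at `n = 0` is the first-flight event** (on the good set): `i` collides in
`(0, w]` and the flight starts of `i` and of its first partner `j` before `t₀` coincide (`|s_i − s_j| ≤ 0`) iff
`t₀ ∈ (0, w]` and `j` takes part in no collision during `(0, t₀)`. [folklore] -/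
theorem window_sameStart_iff_firstFlight : ∀ {σ : ℝ} {N : ℕ} (Φ : Literature.Analysis.FluidPDE.HardSphereFlow (Literature.Analysis.FluidPDE.Torus.geometry (Fin 3)) (Literature.MathematicalPhysics.KineticTheory.hsDiameter σ N) (N + 1)) (i : Fin (N + 1)) {z : Literature.Analysis.FluidPDE.Config (N + 1) (Fin 3) Literature.MathematicalPhysics.KineticTheory.T3}, z ∈ Φ.good → ∀ (w c : ℝ), c = 0 → ((1 ≤ Set.ncard (Literature.Analysis.FluidPDE.collisionTimesOf (Literature.Analysis.FluidPDE.Torus.geometry (Fin 3)) (Literature.MathematicalPhysics.KineticTheory.hsDiameter σ N) (fun t => Φ.flow t z) i ∩ Set.Ioc 0 w) ∧ |Literature.Analysis.FluidPDE.flightStart (Literature.Analysis.FluidPDE.Torus.geometry (Fin 3)) (Literature.MathematicalPhysics.KineticTheory.hsDiameter σ N) (fun t => Φ.flow t z) 0 i (Φ.nthCollisionTimeOf i 0 z) - Literature.Analysis.FluidPDE.flightStart (Literature.Analysis.FluidPDE.Torus.geometry (Fin 3)) (Literature.MathematicalPhysics.KineticTheory.hsDiameter σ N) (fun t => Φ.flow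 t z) 0 (Φ.nthPartnerOf i 0 z) (Φ.nthCollisionTimeOf i 0 z)| ≤ c) ↔ (Φ.nthCollisionTimeOf i 0 z ∈ Set.Ioc 0 w ∧ ∀ u ∈ Set.Ioo 0 (Φ.nthCollisionTimeOf i 0 z), ¬ Literature.Analysis.FluidPDE.Participates (Literature.Analysis.FluidPDE.Torus.geometry (Fin 3)) (Literature.MathematicalPhysics.KineticTheory.hsDiameter σ N) (Φ.flow u z) (Φ.nthPartnerOf i 0 z))) := by
  intro σ N Φ i z hz w c hc
  subst hc
  rw [one_le_ncard_iff_nthCollisionTimeOf_zero_mem Φ i hz w]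
  constructor
  · rintro ⟨ht, hgap⟩
    refine ⟨ht, (flightStart_eq_zero_iff Φ hz _ ht.1).1 ?_⟩
    have h0 := flightStart_self_eq_zero Φ i hz ht.1
    have := abs_nonpos_iff.1 hgap
    rw [h0, zero_sub, neg_eq_zero] at this
    exact this
  · rintro ⟨ht, hfresh⟩
    refine ⟨ht, ?_⟩
    rw [flightStart_self_eq_zero Φ i hz ht.1, (flightStart_eq_zero_iff Φ hz _ ht.1).2 hfresh, sub_zero, abs_zero]

/-- **On the first-flight event both snapshots of the coarse past are the time-`0` configuration.** [folklore] -/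
theorem coarsePastOf_eq_of_firstFlight {C : Type*} (q : T3 → C) (hz : z ∈ Φ.good)
    (ht : 0 < Φ.nthCollisionTimeOf i 0 z)
    (hfresh : ∀ u ∈ Ioo 0 (Φ.nthCollisionTimeOf i 0 z),
      ¬ Participates (Torus.geometry (Fin 3)) (hsDiameter σ N) (Φ.flow u z) (Φ.nthPartnerOf i 0 z)) :
    Φ.coarsePastOf q i 0 z = (coarseConfig q z, coarseConfig q z) := by
  rw [HardSphereFlow.coarsePastOf, flightStart_self_eq_zero Φ i hz ht,
    (flightStart_eq_zero_iff Φ hz _ ht).2 hfresh, Φ.flow_zero z hz]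

/-- **On the first-flight event the two partners fly freely up to `t₀`**: their positions at `t₀` are the
free-flight positions `x + t₀ v` (torus translate) of the time-`0` data. [folklore] -/
theorem pos_nthCollisionTimeOf_eq_translate (hz : z ∈ Φ.good) (ht : 0 < Φ.nthCollisionTimeOf i 0 z)
    (k : Fin (N + 1))
    (hk : ∀ u ∈ Ioo 0 (Φ.nthCollisionTimeOf i 0 z),
      ¬ Participates (Torus.geometry (Fin 3)) (hsDiameter σ N) (Φ.flow u z) k) :
    (Φ.flow (Φ.nthCollisionTimeOf i 0 z) z k).1 =
      (Torus.geometry (Fin 3)).translate (z k).1 (Φ.nthCollisionTimeOf i 0 z • (z k).2) := by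
  have h := orbit_pos_eq_of_forall_not_participates (Φ := Φ) hz k ht.le
    (fun u hu => hk u hu) ⟨ht.le, le_rfl⟩
  simp only [orbit_apply, sub_zero] at h
  rw [h, Φ.flow_zero z hz, Torus.geometry_translate]

/-- **On the first-flight event the recorded impact vector is the contact normal of the two free flights.**
[folklore] -/
theorem impactVec_eq_of_firstFlight (hz : z ∈ Φ.good) (ht : 0 < Φ.nthCollisionTimeOf i 0 z)
    (hfresh : ∀ u ∈ Ioo 0 (Φ.nthCollisionTimeOf i 0 z),
      ¬ Participates (Torus.geometry (Fin 3)) (hsDiameter σ N) (Φ.flow u z) (Φ.nthPartnerOf i 0 z)) :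
    (Φ.nthRecordOf i 0 z).impactVec =
      (hsDiameter σ N)⁻¹ • (Torus.geometry (Fin 3)).sepVec
        ((Torus.geometry (Fin 3)).translate (z i).1 (Φ.nthCollisionTimeOf i 0 z • (z i).2))
        ((Torus.geometry (Fin 3)).translate (z (Φ.nthPartnerOf i 0 z)).1
          (Φ.nthCollisionTimeOf i 0 z • (z (Φ.nthPartnerOf i 0 z)).2)) := by
  rw [HardSphereFlow.nthRecordOf, HardSphereCollisionRecord.ofConfig_impactVec,
    pos_nthCollisionTimeOf_eq_translate Φ i hz ht i
      (fun u hu => not_participates_of_lt_nthCollisionTimeOf_zero Φ i hz ht hu),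
    pos_nthCollisionTimeOf_eq_translate Φ i hz ht _ hfresh]

/-- **The first-flight event is measurable** (the window event and the gap event are measurable on the good set,
`measurableSet_good_inter_le_ncard_collisionTimesOf`, `stub_measurableSet_gap_le`). [folklore] -/
theorem measurableSet_firstFlightEvent (w : ℝ) :
    MeasurableSet (Φ.good ∩ {z : Config (N + 1) (Fin 3) T3 | Φ.nthCollisionTimeOf i 0 z ∈ Ioc 0 w ∧
      ∀ u ∈ Ioo 0 (Φ.nthCollisionTimeOf i 0 z),
        ¬ Participates (Torus.geometry (Fin 3)) (hsDiameter σ N) (Φ.flow u z) (Φ.nthPartnerOf i 0 z)}) := by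
  have h1 := measurableSet_good_inter_le_ncard_collisionTimesOf Φ i 1 w
  have h2 := stub_measurableSet_gap_le Φ i 0 0
  have hFeq : (Φ.good ∩ {z : Config (N + 1) (Fin 3) T3 | Φ.nthCollisionTimeOf i 0 z ∈ Ioc 0 w ∧
      ∀ u ∈ Ioo 0 (Φ.nthCollisionTimeOf i 0 z),
        ¬ Participates (Torus.geometry (Fin 3)) (hsDiameter σ N) (Φ.flow u z) (Φ.nthPartnerOf i 0 z)}) =
      (Φ.good ∩ {z : Config (N + 1) (Fin 3) T3 | 1 ≤ Set.ncard (collisionTimesOf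
          (Torus.geometry (Fin 3)) (hsDiameter σ N) (fun t => Φ.flow t z) i ∩ Set.Ioc 0 w)}) ∩
        (Φ.good ∩ {z : Config (N + 1) (Fin 3) T3 |
          |flightStart (Torus.geometry (Fin 3)) (hsDiameter σ N) (fun t => Φ.flow t z) 0 i
              (Φ.nthCollisionTimeOf i 0 z) -
            flightStart (Torus.geometry (Fin 3)) (hsDiameter σ N) (fun t => Φ.flow t z) 0
              (Φ.nthPartnerOf i 0 z) (Φ.nthCollisionTimeOf i 0 z)| ≤ 0}) := by
    ext z
    simp only [mem_inter_iff, mem_setOf_eq]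
    constructor
    · rintro ⟨hz, hF⟩
      have := (window_sameStart_iff_firstFlight Φ i hz w 0 rfl).2 hF
      exact ⟨⟨hz, this.1⟩, hz, this.2⟩
    · rintro ⟨⟨hz, hW⟩, -, hgap⟩
      exact ⟨hz, (window_sameStart_iff_firstFlight Φ i hz w 0 rfl).1 ⟨hW, hgap⟩⟩
  rw [hFeq]
  exact h1.inter h2

/-- On a good orbit with `0 < t₀` the first partner of `i` is not `i` itself. [folklore] -/
theorem nthPartnerOf_zero_ne_self (hz : z ∈ Φ.good) (h0 : 0 < Φ.nthCollisionTimeOf i 0 z) :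
    Φ.nthPartnerOf i 0 z ≠ i := by
  have hpart : Participates (Torus.geometry (Fin 3)) (hsDiameter σ N)
      (Φ.flow (Φ.nthCollisionTimeOf i 0 z) z) i := (isLeast_of_nthCollisionTimeOf_zero_pos Φ i hz h0).1.1
  exact (collide_partner hpart).ne.symm

/-- On the first-flight event the position of a partner `k ∈ {i, j}` at every time `t ∈ [0, t₀]` is its free-flight
position `(freeFlight t z k).1`. [folklore] -/
theorem pos_eq_freeFlight_of_le (hz : z ∈ Φ.good) (ht : 0 < Φ.nthCollisionTimeOf i 0 z) (k : Fin (N + 1))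
    (hk : ∀ u ∈ Ioo 0 (Φ.nthCollisionTimeOf i 0 z),
      ¬ Participates (Torus.geometry (Fin 3)) (hsDiameter σ N) (Φ.flow u z) k)
    {t : ℝ} (h0t : 0 ≤ t) (htt : t ≤ Φ.nthCollisionTimeOf i 0 z) :
    (Φ.flow t z k).1 = (freeFlight (Torus.geometry (Fin 3)) t z k).1 := by
  have h := orbit_pos_eq_of_forall_not_participates (Φ := Φ) hz k ht.le (fun u hu => hk u hu) ⟨h0t, htt⟩
  simp only [orbit_apply, sub_zero] at h
  rw [h, Φ.flow_zero z hz, freeFlight_apply, Torus.geometry_translate]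

/-- **On the first-flight event the first collision time of `i` is the ENTRANCE TIME of the two free flights**:
`t₀` is the least `t > 0` at which the free flights `x_i + t v_i`, `x_j + t v_j` of `i` and of its (fresh) first
partner `j` are within `ε` (so `t₀`, and with it the contact normal, is an explicit function of the time-`0` data of
the pair). Uses `0 < ε` only through the hard-sphere domain (`‖x_i − x_j‖ ≥ ε` for `i ≠ j`). [folklore] -/
theorem isLeast_freeFlightEntrance_nthCollisionTimeOf_zero (hz : z ∈ Φ.good) (ht : 0 < Φ.nthCollisionTimeOf i 0 z)
    {j : Fin (N + 1)} (hj : Φ.nthPartnerOf i 0 z = j)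
    (hfresh : ∀ u ∈ Ioo 0 (Φ.nthCollisionTimeOf i 0 z),
      ¬ Participates (Torus.geometry (Fin 3)) (hsDiameter σ N) (Φ.flow u z) j) :
    IsLeast {t : ℝ | 0 < t ∧ ‖(Torus.geometry (Fin 3)).sepVec (freeFlight (Torus.geometry (Fin 3)) t z i).1
        (freeFlight (Torus.geometry (Fin 3)) t z j).1‖ ≤ hsDiameter σ N} (Φ.nthCollisionTimeOf i 0 z) := by
  set t₀ := Φ.nthCollisionTimeOf i 0 z with ht₀def
  have hG : ∀ x y : T3, ‖(Torus.geometry (Fin 3)).sepVec x y‖ = ‖(Torus.geometry (Fin 3)).sepVec y x‖ := by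
    intro x y
    rw [Torus.norm_geometry_sepVec, Torus.norm_geometry_sepVec, Torus.euclidDist_comm]
  have hfi : ∀ u ∈ Ioo 0 t₀, ¬ Participates (Torus.geometry (Fin 3)) (hsDiameter σ N) (Φ.flow u z) i :=
    fun u hu => not_participates_of_lt_nthCollisionTimeOf_zero Φ i hz ht hu
  have hji : j ≠ i := hj ▸ nthPartnerOf_zero_ne_self Φ i hz ht
  constructor
  · -- `t₀` is an entrance time: `i` and `j` are in contact at `t₀`, at their free-flight positions
    refine ⟨ht, ?_⟩
    have hpart : Participates (Torus.geometry (Fin 3)) (hsDiameter σ N) (Φ.flow t₀ z) i :=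
      (isLeast_of_nthCollisionTimeOf_zero_pos Φ i hz ht).1.1
    have hcol : Collide (Torus.geometry (Fin 3)) (hsDiameter σ N) (Φ.flow t₀ z) i j := by
      have := collide_partner hpart
      rwa [show partner (Torus.geometry (Fin 3)) (hsDiameter σ N) (Φ.flow t₀ z) i = j from hj] at this
    have hnorm : ‖(Torus.geometry (Fin 3)).sepVec (Φ.flow t₀ z i).1 (Φ.flow t₀ z j).1‖ = hsDiameter σ N := by
      rcases hcol with h1 | h2
      · exact (mem_contactSet.1 (mem_contactPairs.1 h1).2).2
      · rw [hG]; exact (mem_contactSet.1 (mem_contactPairs.1 h2).2).2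
    rw [pos_eq_freeFlight_of_le Φ i hz ht i hfi ht.le le_rfl,
      pos_eq_freeFlight_of_le Φ i hz ht j hfresh ht.le le_rfl] at hnorm
    · exact hnorm.le
  · -- no earlier entrance: an earlier `ε`-approach of the free flights would be a contact of `i` before `t₀`
    rintro t ⟨h0t, hle⟩
    by_contra hlt
    rw [not_le] at hlt
    have hposi := pos_eq_freeFlight_of_le Φ i hz ht i hfi h0t.le hlt.le
    have hposj := pos_eq_freeFlight_of_le Φ i hz ht j hfresh h0t.le hlt.le
    rw [← hposi, ← hposj] at hle
    have hdom := (Φ.isTrajectory z hz).mem t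
    have hge : hsDiameter σ N ≤ ‖(Torus.geometry (Fin 3)).sepVec (Φ.flow t z i).1 (Φ.flow t z j).1‖ :=
      mem_hardSphereDomain.1 hdom i j hji.symm
    have heq : ‖(Torus.geometry (Fin 3)).sepVec (Φ.flow t z i).1 (Φ.flow t z j).1‖ = hsDiameter σ N :=
      le_antisymm hle hge
    have hpair : (i, j) ∈ contactPairs (Torus.geometry (Fin 3)) (hsDiameter σ N) (Φ.flow t z) :=
      mem_contactPairs.2 ⟨hji.symm, mem_contactSet.2 ⟨hdom, heq⟩⟩
    exact hfi t ⟨h0t, hlt⟩ ⟨j, Or.inl hpair⟩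

end FirstCollision

end

end Summit.AtomisticToContinuum.HydrodynamicLimit.Theorems.OLC
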